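import Summits.Ventures.PercRepro.Night2ShapeOneSideNF

/-!
# PercRepro — the seven-point shape (i): the side carrying the FAT `K`-face (night-2, gen 30)

In the K-FAT regime (`H` thin or a non-member, one `K`-face the fat closure with request `7/24`) the fat face is null
(`m = 2`, `s = 0`): every visible point of its side is attached to it, so — for the fat face `1` — `fE = zf = 0`,
`a₂ = z₂ = a₃ = z₃ = 0`, `s₂ = s₃ = N := a₁ + z₁`, `g₁ = 1 + N`, `g₂ = g₃ = 1 + z₁`.  The side's load is then explicit
(proofs/NIGHT-2-g30.md §3, KF1–KF4): with `r_H ≤ 7/30` the two sources `2`, `3` lose at most `(7/30 + 7/24 + ρ(2 + N)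
− 11/18)⁺` each (`106/720` at `N = 1`, `78/720` at `N ≥ 2`) and the source `1` at most `(7/30 + 2ρ(2 + N) − 11/18)⁺`
(`64/720` at `N = 1`, `8/720` at `N ≥ 2`): **KF1** `≤ 244/720` always, **KF2** `≤ 138/720` with a visible `Z`-point,
**KF3** `≤ 159/720` with `N ≥ 2`, **KF4** `≤ 174/720` with `r_H ≤ 7/36`, and `0` with `N = 0`.
-/

namespace PercRepro.Shadow

section SideKF

variable {fE a₁ a₂ a₃ zf z₁ z₂ z₃ s₁ s₂ s₃ g₁ g₂ g₃ : ℕ} {r₂ r₃ rH : ℚ}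

/-- The loss of a source whose faces are the fat face and a face with `s ≥ 1` (`r_H ≤ 7/30`). -/
theorem lossKF_le {s : ℕ} {r : ℚ} (hH : rH ≤ 7 / 30) (hr : r ≤ rhoReq (2 + s)) (h0 : s = 0 → r = 0) :
    max (rH + 7 / 24 + r - 11 / 18) 0 ≤ 106 / 720 ∧ (2 ≤ s → max (rH + 7 / 24 + r - 11 / 18) 0 ≤ 78 / 720) ∧
      (s = 0 → max (rH + 7 / 24 + r - 11 / 18) 0 = 0) := by
  have ht := req_le_thin_of_adm hr h0
  refine ⟨max_le (by linarith) (by norm_num), fun hs => ?_, fun hs => ?_⟩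
  · have := rhoReq_anti (m := 4) (m' := 2 + s) (by omega)
    rw [rhoReq_four] at this
    exact max_le (by linarith) (by norm_num)
  · rw [h0 hs]; exact max_eq_right (by linarith)

/-- The loss of the fat face's own source (faces `2`, `3`, both with `s = N`; `r_H ≤ 7/30`). -/
theorem lossKF_own_le {s : ℕ} {ra rb : ℚ} (hH : rH ≤ 7 / 30) (hra : ra ≤ rhoReq (2 + s)) (ha0 : s = 0 → ra = 0)
    (hrb : rb ≤ rhoReq (2 + s)) (hb0 : s = 0 → rb = 0) :
    max (rH + ra + rb - 11 / 18) 0 ≤ 64 / 720 ∧ (2 ≤ s → max (rH + ra + rb - 11 / 18) 0 ≤ 8 / 720) ∧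
      (s = 0 → max (rH + ra + rb - 11 / 18) 0 = 0) := by
  have hat := req_le_thin_of_adm hra ha0
  have hbt := req_le_thin_of_adm hrb hb0
  refine ⟨max_le (by linarith) (by norm_num), fun hs => ?_, fun hs => ?_⟩
  · have := rhoReq_anti (m := 4) (m' := 2 + s) (by omega)
    rw [rhoReq_four] at this
    exact max_le (by linarith) (by norm_num)
  · rw [ha0 hs, hb0 hs]; exact max_eq_right (by linarith)

set_option maxHeartbeats 800000 in
/-- **KF1–KF3 and the `N = 0` case.** The side whose face `1` is fat (`s₁ = 0`), with `r_H ≤ 7/30`: the load is at most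
`244/720`; at most `138/720` when the `Z`-point attached to `1` is visible (`z₁ ≥ 1`); at most `159/720` when `N ≥ 2`;
`0` when `N = 0`. -/
theorem sideKF_le
    (hs₁ : s₁ = fE + zf + (a₂ + z₂) + (a₃ + z₃)) (hs₂ : s₂ = fE + zf + (a₁ + z₁) + (a₃ + z₃))
    (hs₃ : s₃ = fE + zf + (a₁ + z₁) + (a₂ + z₂))
    (hg₁ : g₁ = 1 + fE + a₁ + zf + (z₁ + z₂ + z₃)) (hg₂ : g₂ = 1 + fE + a₂ + zf + (z₁ + z₂ + z₃))
    (hg₃ : g₃ = 1 + fE + a₃ + zf + (z₁ + z₂ + z₃))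
    (hfat : s₁ = 0) (hr₂ : r₂ ≤ rhoReq (2 + s₂)) (h₂0 : s₂ = 0 → r₂ = 0) (hr₃ : r₃ ≤ rhoReq (2 + s₃))
    (h₃0 : s₃ = 0 → r₃ = 0) (hH : rH ≤ 7 / 30) :
    max (rH + r₂ + r₃ - 11 / 18) 0 / (g₁ : ℚ) + max (rH + 7 / 24 + r₃ - 11 / 18) 0 / (g₂ : ℚ) +
      max (rH + 7 / 24 + r₂ - 11 / 18) 0 / (g₃ : ℚ) ≤ 244 / 720 ∧
    (1 ≤ z₁ → max (rH + r₂ + r₃ - 11 / 18) 0 / (g₁ : ℚ) + max (rH + 7 / 24 + r₃ - 11 / 18) 0 / (g₂ : ℚ) +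
      max (rH + 7 / 24 + r₂ - 11 / 18) 0 / (g₃ : ℚ) ≤ 138 / 720) ∧
    (2 ≤ a₁ + z₁ → max (rH + r₂ + r₃ - 11 / 18) 0 / (g₁ : ℚ) + max (rH + 7 / 24 + r₃ - 11 / 18) 0 / (g₂ : ℚ) +
      max (rH + 7 / 24 + r₂ - 11 / 18) 0 / (g₃ : ℚ) ≤ 159 / 720) ∧
    (a₁ + z₁ = 0 → max (rH + r₂ + r₃ - 11 / 18) 0 / (g₁ : ℚ) + max (rH + 7 / 24 + r₃ - 11 / 18) 0 / (g₂ : ℚ) +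
      max (rH + 7 / 24 + r₂ - 11 / 18) 0 / (g₃ : ℚ) ≤ 0) := by
  have hs₂' : s₂ = a₁ + z₁ := by omega
  have hs₃' : s₃ = a₁ + z₁ := by omega
  rw [hs₂'] at hr₂ h₂0
  rw [hs₃'] at hr₃ h₃0
  obtain ⟨b₂, b₂', b₂0⟩ := lossKF_le hH hr₃ h₃0
  obtain ⟨b₃, b₃', b₃0⟩ := lossKF_le hH hr₂ h₂0
  obtain ⟨b₁, b₁', b₁0⟩ := lossKF_own_le hH hr₂ h₂0 hr₃ h₃0
  have hL₁ : 0 ≤ max (rH + r₂ + r₃ - 11 / 18) 0 := le_max_right _ _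
  have hL₂ : 0 ≤ max (rH + 7 / 24 + r₃ - 11 / 18) 0 := le_max_right _ _
  have hL₃ : 0 ≤ max (rH + 7 / 24 + r₂ - 11 / 18) 0 := le_max_right _ _
  have hg₁' : g₁ = 1 + (a₁ + z₁) := by omega
  have hg₂' : g₂ = 1 + z₁ := by omega
  have hg₃' : g₃ = 1 + z₁ := by omega
  -- the N = 0 case
  have case0 : a₁ + z₁ = 0 → max (rH + r₂ + r₃ - 11 / 18) 0 / (g₁ : ℚ) + max (rH + 7 / 24 + r₃ - 11 / 18) 0 / (g₂ : ℚ) +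
      max (rH + 7 / 24 + r₂ - 11 / 18) 0 / (g₃ : ℚ) ≤ 0 := by
    intro hN
    rw [b₁0 hN, b₂0 hN, b₃0 hN, zero_div_nat, zero_div_nat, zero_div_nat]
    norm_num
  refine ⟨?_, ?_, ?_, case0⟩
  · -- always
    rcases Nat.eq_zero_or_pos (a₁ + z₁) with hN | hN
    · have := case0 hN; linarith
    rcases Nat.lt_or_ge (a₁ + z₁) 2 with hN1 | hN2
    · -- `N = 1`
      have t₁ := div_nat_le_div_of_le hL₁ b₁ (g := g₁) (k := 2) (by norm_num) (by omega)
      have t₂ := div_nat_le_div_of_le hL₂ b₂ (g := g₂) (k := 1) (by norm_num) (by omega)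
      have t₃ := div_nat_le_div_of_le hL₃ b₃ (g := g₃) (k := 1) (by norm_num) (by omega)
      norm_num at t₁ t₂ t₃
      linarith
    · have t₁ := div_nat_le_div_of_le hL₁ (b₁' hN2) (g := g₁) (k := 3) (by norm_num) (by omega)
      have t₂ := div_nat_le_div_of_le hL₂ (b₂' hN2) (g := g₂) (k := 1) (by norm_num) (by omega)
      have t₃ := div_nat_le_div_of_le hL₃ (b₃' hN2) (g := g₃) (k := 1) (by norm_num) (by omega)
      norm_num at t₁ t₂ t₃
      linarith
  · -- a visible `Z`-point: `g₂ = g₃ ≥ 2`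
    intro hz
    have t₁ := div_nat_le_div_of_le hL₁ b₁ (g := g₁) (k := 2) (by norm_num) (by omega)
    have t₂ := div_nat_le_div_of_le hL₂ b₂ (g := g₂) (k := 2) (by norm_num) (by omega)
    have t₃ := div_nat_le_div_of_le hL₃ b₃ (g := g₃) (k := 2) (by norm_num) (by omega)
    norm_num at t₁ t₂ t₃
    linarith
  · intro hN2
    have t₁ := div_nat_le_div_of_le hL₁ (b₁' hN2) (g := g₁) (k := 3) (by norm_num) (by omega)
    have t₂ := div_nat_le_div_of_le hL₂ (b₂' hN2) (g := g₂) (k := 1) (by norm_num) (by omega)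
    have t₃ := div_nat_le_div_of_le hL₃ (b₃' hN2) (g := g₃) (k := 1) (by norm_num) (by omega)
    norm_num at t₁ t₂ t₃
    linarith

/-- **KF4.** The fat side with `r_H ≤ 7/36` (`m_H ≥ 4`): the load is at most `174/720`. -/
theorem sideKF_le_rH36
    (hs₁ : s₁ = fE + zf + (a₂ + z₂) + (a₃ + z₃)) (hs₂ : s₂ = fE + zf + (a₁ + z₁) + (a₃ + z₃))
    (hs₃ : s₃ = fE + zf + (a₁ + z₁) + (a₂ + z₂))
    (hg₁ : g₁ = 1 + fE + a₁ + zf + (z₁ + z₂ + z₃)) (hg₂ : g₂ = 1 + fE + a₂ + zf + (z₁ + z₂ + z₃))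
    (hg₃ : g₃ = 1 + fE + a₃ + zf + (z₁ + z₂ + z₃))
    (hfat : s₁ = 0) (hr₂ : r₂ ≤ rhoReq (2 + s₂)) (h₂0 : s₂ = 0 → r₂ = 0) (hr₃ : r₃ ≤ rhoReq (2 + s₃))
    (h₃0 : s₃ = 0 → r₃ = 0) (hH : rH ≤ 7 / 36) :
    max (rH + r₂ + r₃ - 11 / 18) 0 / (g₁ : ℚ) + max (rH + 7 / 24 + r₃ - 11 / 18) 0 / (g₂ : ℚ) +
      max (rH + 7 / 24 + r₂ - 11 / 18) 0 / (g₃ : ℚ) ≤ 174 / 720 := by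
  have hs₂' : s₂ = a₁ + z₁ := by omega
  have hs₃' : s₃ = a₁ + z₁ := by omega
  rw [hs₂'] at hr₂ h₂0
  rw [hs₃'] at hr₃ h₃0
  have a₂t := req_le_thin_of_adm hr₂ h₂0
  have a₃t := req_le_thin_of_adm hr₃ h₃0
  have hL₁ : 0 ≤ max (rH + r₂ + r₃ - 11 / 18) 0 := le_max_right _ _
  have hL₂ : 0 ≤ max (rH + 7 / 24 + r₃ - 11 / 18) 0 := le_max_right _ _
  have hL₃ : 0 ≤ max (rH + 7 / 24 + r₂ - 11 / 18) 0 := le_max_right _ _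
  have b₂ : max (rH + 7 / 24 + r₃ - 11 / 18) 0 ≤ 78 / 720 := max_le (by linarith) (by norm_num)
  have b₃ : max (rH + 7 / 24 + r₂ - 11 / 18) 0 ≤ 78 / 720 := max_le (by linarith) (by norm_num)
  have b₁ : max (rH + r₂ + r₃ - 11 / 18) 0 ≤ 36 / 720 := max_le (by linarith) (by norm_num)
  rcases Nat.eq_zero_or_pos (a₁ + z₁) with hN | hN
  · have h20 : r₂ = 0 := h₂0 hN
    have h30 : r₃ = 0 := h₃0 hN
    have u₁ : max (rH + r₂ + r₃ - 11 / 18) 0 = 0 := by rw [h20, h30]; exact max_eq_right (by linarith)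
    have u₂ : max (rH + 7 / 24 + r₃ - 11 / 18) 0 = 0 := by rw [h30]; exact max_eq_right (by linarith)
    have u₃ : max (rH + 7 / 24 + r₂ - 11 / 18) 0 = 0 := by rw [h20]; exact max_eq_right (by linarith)
    rw [u₁, u₂, u₃, zero_div_nat, zero_div_nat, zero_div_nat]
    norm_num
  · have t₁ := div_nat_le_div_of_le hL₁ b₁ (g := g₁) (k := 2) (by norm_num) (by omega)
    have t₂ := div_nat_le_div_of_le hL₂ b₂ (g := g₂) (k := 1) (by norm_num) (by omega)
    have t₃ := div_nat_le_div_of_le hL₃ b₃ (g := g₃) (k := 1) (by norm_num) (by omega)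
    norm_num at t₁ t₂ t₃
    linarith

end SideKF

end PercRepro.Shadow
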